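import Mathlib.Analysis.Complex.CauchyIntegral
import Mathlib.Analysis.Fourier.Inversion
import Mathlib.Analysis.SpecialFunctions.ImproperIntegrals
import Mathlib.Analysis.SpecialFunctions.PolynomialExp
import Mathlib.MeasureTheory.Function.ConvergenceInMeasure
import Literature.Analysis.FunctionSpaces.PlancherelL1L2
import Literature.Analysis.Fourier.SmoothWindowKernel
import HarnessLib

/-!
# Paley–Wiener on the upper half-plane: Fourier transforms of horizontal slices

Topic `Literature/Analysis/Fourier`. For a function `G` holomorphic on the open upper half-plane
`{Im z > 0}` with the pointwise majorant `‖G(x+iy)‖ ≤ A (1+y)^N / (1+x²)` (so every horizontal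
slice `g_y = G(· + iy)` is in `L¹ ∩ L²`), we prove the classical facts behind the Paley–Wiener
theorem for the Hardy space `H²` of the half-plane (e.g. Katznelson, *An introduction to harmonic
analysis*, VI.7; Rudin, *Real and complex analysis*, Thm. 19.2), in elementary form:

* `fourier_upperSlice_eq_exp_mul` — `𝓕 g_{y₂}(ξ) = e^{-2π(y₂-y₁)ξ} 𝓕 g_{y₁}(ξ)` (Cauchy–Goursat on long
  rectangles, Mathlib's `Complex.integral_boundary_rect_eq_zero_of_differentiableOn`);
* `fourier_upperSlice_eq_zero_of_neg` — `𝓕 g_y(ξ) = 0` for `ξ < 0` (let the upper side go to `+i∞`: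
  polynomial growth loses against `e^{2π(Y-y)ξ}`);
* `integrable_fourier_upperSlice`, `fourierInv_fourier_upperSlice` — `𝓕 g_y ∈ L¹` and `g_y = 𝓕⁻ 𝓕 g_y`;
* `paleyWiener_halfPlane_boundaryValue` — the spectral function `φ(ξ) = e^{2πyξ} 𝓕 g_y(ξ)`
  (independent of `y`, vanishing on `ξ < 0`) is in `L²`, and the slices `g_{1/(n+1)}` converge in
  `L²` (and a.e. along a subsequence) to a boundary function `g ∈ L²` with
  `∫ φ η = ∫ g 𝓕η` for all `η ∈ L¹ ∩ L²`, and `g = 𝓕⁻ φ'` a.e. whenever `φ' = φ` a.e. is integrable.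

These are the inputs of the explicit (Beurling–Malliavin-free) multiplier construction for the
Bourgain–Dyatlov fractal uncertainty principle following Jin–Zhang (arXiv:1710.00250, §3).
All statements are folklore; no definitions are introduced.
-/

namespace Literature.Analysis.Fourier

open _root_.MeasureTheory Set Filter _root_.Complex
open scoped FourierTransform Real Topology ENNReal

section Slices

variable {G : ℂ → ℂ} {A : ℝ} {N : ℕ}

/-- The majorant forces `A ≥ 0`. [folklore] -/
theorem nonneg_of_upperSliceBound
    (hb : ∀ x y : ℝ, 0 < y → ‖G (x + y * I)‖ ≤ A * (1 + y) ^ N / (1 + x ^ 2)) : 0 ≤ A := by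
  have h := (norm_nonneg _).trans (hb 0 1 one_pos)
  have h2 : (0 : ℝ) < (1 + 1) ^ N := by positivity
  rw [le_div_iff₀ (by norm_num), zero_mul] at h
  nlinarith

/-- Horizontal slices of a function holomorphic on the open upper half-plane are continuous.
[folklore] -/
theorem continuous_upperSlice (hd : ∀ z : ℂ, 0 < z.im → DifferentiableAt ℂ G z) {y : ℝ} (hy : 0 < y) :
    Continuous fun x : ℝ => G (x + y * I) := by
  refine continuous_iff_continuousAt.2 fun x => ?_
  have h1 : ContinuousAt G ((x : ℂ) + y * I) := (hd _ (by simpa using hy)).continuousAt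
  have h2 : ContinuousAt (fun x : ℝ => (x : ℂ) + y * I) x := by fun_prop
  exact ContinuousAt.comp_of_eq h1 h2 rfl

/-- Slices are integrable under the majorant `A(1+y)^N/(1+x²)`. [folklore] -/
theorem integrable_upperSlice (hd : ∀ z : ℂ, 0 < z.im → DifferentiableAt ℂ G z)
    (hb : ∀ x y : ℝ, 0 < y → ‖G (x + y * I)‖ ≤ A * (1 + y) ^ N / (1 + x ^ 2)) {y : ℝ} (hy : 0 < y) :
    Integrable fun x : ℝ => G (x + y * I) := by
  refine Integrable.mono' ((integrable_inv_one_add_sq).const_mul (A * (1 + y) ^ N))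
    (continuous_upperSlice hd hy).aestronglyMeasurable (Eventually.of_forall fun x => ?_)
  have := hb x y hy
  rwa [div_eq_mul_inv] at this

/-- `L¹` norm of a slice: `∫ ‖g_y‖ ≤ π A (1+y)^N`. [folklore] -/
theorem integral_norm_upperSlice_le
    (hb : ∀ x y : ℝ, 0 < y → ‖G (x + y * I)‖ ≤ A * (1 + y) ^ N / (1 + x ^ 2)) {y : ℝ} (hy : 0 < y) :
    ∫ x : ℝ, ‖G (x + y * I)‖ ≤ π * (A * (1 + y) ^ N) := by
  have h1 : ∫ x : ℝ, ‖G (x + y * I)‖ ≤ ∫ x : ℝ, A * (1 + y) ^ N * (1 + x ^ 2)⁻¹ := by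
    refine integral_mono_of_nonneg (Eventually.of_forall fun _ => norm_nonneg _)
      ((integrable_inv_one_add_sq).const_mul _) (Eventually.of_forall fun x => ?_)
    have := hb x y hy
    rwa [div_eq_mul_inv] at this
  refine h1.trans (le_of_eq ?_)
  rw [integral_const_mul, integral_univ_inv_one_add_sq]
  ring

/-- Sup bound for the Fourier transform of a slice: `‖𝓕 g_y(ξ)‖ ≤ π A (1+y)^N`. [folklore] -/
theorem norm_fourier_upperSlice_le
    (hb : ∀ x y : ℝ, 0 < y → ‖G (x + y * I)‖ ≤ A * (1 + y) ^ N / (1 + x ^ 2)) {y : ℝ} (hy : 0 < y)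
    (ξ : ℝ) : ‖𝓕 (fun x : ℝ => G (x + y * I)) ξ‖ ≤ π * (A * (1 + y) ^ N) :=
  (VectorFourier.norm_fourierIntegral_le_integral_norm _ _ _ _ _).trans (integral_norm_upperSlice_le hb hy)

/-- Slices are square integrable, with `∫ ‖g_y‖² ≤ π A² (1+y)^{2N}`. [folklore] -/
theorem integral_norm_sq_upperSlice_le (hd : ∀ z : ℂ, 0 < z.im → DifferentiableAt ℂ G z)
    (hb : ∀ x y : ℝ, 0 < y → ‖G (x + y * I)‖ ≤ A * (1 + y) ^ N / (1 + x ^ 2)) {y : ℝ} (hy : 0 < y) :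
    Integrable (fun x : ℝ => ‖G (x + y * I)‖ ^ 2) ∧
      ∫ x : ℝ, ‖G (x + y * I)‖ ^ 2 ≤ π * (A * (1 + y) ^ N) ^ 2 := by
  have hA := nonneg_of_upperSliceBound hb
  have hpt : ∀ x : ℝ, ‖G (x + y * I)‖ ^ 2 ≤ (A * (1 + y) ^ N) ^ 2 * (1 + x ^ 2)⁻¹ := by
    intro x
    have h1 := hb x y hy
    have hx : (0 : ℝ) < 1 + x ^ 2 := by positivity
    have h2 : A * (1 + y) ^ N / (1 + x ^ 2) ≤ A * (1 + y) ^ N := by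
      rw [div_le_iff₀ hx]; nlinarith [mul_nonneg hA (pow_nonneg (by linarith : (0:ℝ) ≤ 1 + y) N)]
    calc ‖G (x + y * I)‖ ^ 2 ≤ (A * (1 + y) ^ N / (1 + x ^ 2)) * (A * (1 + y) ^ N) :=
          by rw [sq]; exact mul_le_mul h1 (h1.trans h2) (norm_nonneg _) (by positivity)
      _ = (A * (1 + y) ^ N) ^ 2 * (1 + x ^ 2)⁻¹ := by ring
  have hint : Integrable (fun x : ℝ => ‖G (x + y * I)‖ ^ 2) := by
    refine Integrable.mono' ((integrable_inv_one_add_sq).const_mul ((A * (1 + y) ^ N) ^ 2))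
      ((continuous_upperSlice hd hy).norm.pow 2).aestronglyMeasurable
      (Eventually.of_forall fun x => ?_)
    rw [Real.norm_eq_abs, abs_of_nonneg (by positivity)]
    exact hpt x
  refine ⟨hint, ?_⟩
  calc ∫ x : ℝ, ‖G (x + y * I)‖ ^ 2 ≤ ∫ x : ℝ, (A * (1 + y) ^ N) ^ 2 * (1 + x ^ 2)⁻¹ :=
        integral_mono hint ((integrable_inv_one_add_sq).const_mul _) hpt
    _ = π * (A * (1 + y) ^ N) ^ 2 := by
        rw [integral_const_mul, integral_univ_inv_one_add_sq]; ring

/-- Slices are in `L²`. [folklore] -/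
theorem memLp_two_upperSlice (hd : ∀ z : ℂ, 0 < z.im → DifferentiableAt ℂ G z)
    (hb : ∀ x y : ℝ, 0 < y → ‖G (x + y * I)‖ ≤ A * (1 + y) ^ N / (1 + x ^ 2)) {y : ℝ} (hy : 0 < y) :
    MemLp (fun x : ℝ => G (x + y * I)) 2 volume :=
  (memLp_two_iff_integrable_sq_norm (continuous_upperSlice hd hy).aestronglyMeasurable).2
    (integral_norm_sq_upperSlice_le hd hb hy).1

/-- The Fourier transform of a slice, written with the Fourier–Laplace kernel:
`e^{2πyξ} 𝓕 g_y(ξ) = ∫ e^{-2πi(x+iy)ξ} G(x+iy) dx`. [folklore] -/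
theorem exp_mul_fourier_upperSlice_eq (y ξ : ℝ) :
    cexp (2 * π * y * ξ) * 𝓕 (fun x : ℝ => G (x + y * I)) ξ =
      ∫ x : ℝ, cexp (-(2 * π * I * (x + y * I) * ξ)) * G (x + y * I) := by
  rw [Real.fourier_real_eq_integral_exp_smul, ← integral_const_mul]
  congr 1
  funext x
  rw [smul_eq_mul, ← mul_assoc, ← Complex.exp_add]
  congr 2
  have hI : I * I = -1 := I_mul_I
  push_cast
  linear_combination (2 * (π : ℂ) * y * ξ) * hI

/-- **Vertical translation of slices multiplies the Fourier transform by an exponential**: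
`𝓕 g_{y₂}(ξ) = e^{-2π(y₂-y₁)ξ} 𝓕 g_{y₁}(ξ)` for `y₁, y₂ > 0` (Cauchy–Goursat on `[-R,R]×[y₁,y₂]`,
the vertical sides being `O(R⁻²)`). [folklore] -/
theorem fourier_upperSlice_eq_exp_mul (hd : ∀ z : ℂ, 0 < z.im → DifferentiableAt ℂ G z)
    (hb : ∀ x y : ℝ, 0 < y → ‖G (x + y * I)‖ ≤ A * (1 + y) ^ N / (1 + x ^ 2))
    {y₁ y₂ : ℝ} (hy₁ : 0 < y₁) (hy₂ : 0 < y₂) (ξ : ℝ) :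
    𝓕 (fun x : ℝ => G (x + y₂ * I)) ξ =
      cexp (-(2 * π * (y₂ - y₁) * ξ)) * 𝓕 (fun x : ℝ => G (x + y₁ * I)) ξ := by
  have hA := nonneg_of_upperSliceBound hb
  -- the holomorphic integrand
  set F : ℂ → ℂ := fun z => cexp (-(2 * π * I * z * ξ)) * G z with hF
  have hFd : ∀ z : ℂ, 0 < z.im → DifferentiableAt ℂ F z := fun z hz =>
    (((differentiableAt_id.const_mul _).mul_const _).neg.cexp).mul (hd z hz)
  -- norm of the kernel on the line `Im z = y`
  have hker : ∀ (x y : ℝ), ‖cexp (-(2 * π * I * (x + y * I) * ξ))‖ = Real.exp (2 * π * y * ξ) := by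
    intro x y
    rw [Complex.norm_exp]
    congr 1
    have hI : I * I = -1 := I_mul_I
    simp only [neg_re, mul_re, mul_im, I_re, I_im, ofReal_re, ofReal_im, add_re, add_im,
      re_ofNat, im_ofNat]
    ring
  -- slices of `F` are integrable
  have hFi : ∀ y : ℝ, 0 < y → Integrable fun x : ℝ => F (x + y * I) := by
    intro y hy
    have hc : Continuous fun x : ℝ => F (x + y * I) := by
      change Continuous fun x : ℝ => cexp (-(2 * π * I * (x + y * I) * ξ)) * G (x + y * I)
      exact (by fun_prop : Continuous fun x : ℝ => cexp (-(2 * π * I * (x + y * I) * ξ))).mul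
        (continuous_upperSlice hd hy)
    refine Integrable.mono' (((integrable_upperSlice hd hb hy).norm).const_mul (Real.exp (2 * π * y * ξ)))
      hc.aestronglyMeasurable (Eventually.of_forall fun x => ?_)
    change ‖cexp (-(2 * π * I * (x + y * I) * ξ)) * G (x + y * I)‖ ≤ _
    rw [norm_mul, hker]
  -- the identity to prove, in terms of `F`
  have hgoal : ∀ y : ℝ, 0 < y →
      cexp (2 * π * y * ξ) * 𝓕 (fun x : ℝ => G (x + y * I)) ξ = ∫ x : ℝ, F (x + y * I) :=
    fun y _ => exp_mul_fourier_upperSlice_eq y ξ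
  suffices hmain : (∫ x : ℝ, F (x + y₁ * I)) = ∫ x : ℝ, F (x + y₂ * I) by
    have h1 := hgoal y₁ hy₁
    have h2 := hgoal y₂ hy₂
    rw [← hmain, ← h1] at h2
    have hne : cexp (2 * π * y₂ * ξ) ≠ 0 := Complex.exp_ne_zero _
    calc 𝓕 (fun x : ℝ => G (x + y₂ * I)) ξ
        = (cexp (2 * π * y₂ * ξ))⁻¹ * (cexp (2 * π * y₂ * ξ) * 𝓕 (fun x : ℝ => G (x + y₂ * I)) ξ) := by
          field_simp
      _ = (cexp (2 * π * y₂ * ξ))⁻¹ * (cexp (2 * π * y₁ * ξ) * 𝓕 (fun x : ℝ => G (x + y₁ * I)) ξ) := by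
          rw [h2]
      _ = cexp (-(2 * π * (y₂ - y₁) * ξ)) * 𝓕 (fun x : ℝ => G (x + y₁ * I)) ξ := by
          rw [← mul_assoc, ← Complex.exp_neg, ← Complex.exp_add]
          congr 2
          ring
  -- both sides are limits of truncated integrals
  have hlim1 : Tendsto (fun R : ℝ => ∫ x in -R..R, F (x + y₁ * I)) atTop (𝓝 (∫ x : ℝ, F (x + y₁ * I))) :=
    intervalIntegral_tendsto_integral (hFi y₁ hy₁) tendsto_neg_atTop_atBot tendsto_id
  have hlim2 : Tendsto (fun R : ℝ => ∫ x in -R..R, F (x + y₂ * I)) atTop (𝓝 (∫ x : ℝ, F (x + y₂ * I))) :=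
    intervalIntegral_tendsto_integral (hFi y₂ hy₂) tendsto_neg_atTop_atBot tendsto_id
  -- their difference tends to zero
  set ymin : ℝ := min y₁ y₂ with hymin
  set ymax : ℝ := max y₁ y₂ with hymax
  have hymin_pos : 0 < ymin := lt_min hy₁ hy₂
  set K : ℝ := Real.exp (2 * π * ymax * |ξ|) * (A * (1 + ymax) ^ N) with hK
  have hKnn : 0 ≤ K := by positivity
  -- pointwise bound for `F` on the vertical sides
  have hFside : ∀ (s y : ℝ), y ∈ Set.uIcc y₁ y₂ → ‖F (s + y * I)‖ ≤ K / (1 + s ^ 2) := by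
    intro s y hy
    have hy' : ymin ≤ y ∧ y ≤ ymax := by
      rcases Set.mem_uIcc.1 hy with h | h
      · exact ⟨(min_le_left _ _).trans h.1, h.2.trans (le_max_right _ _)⟩
      · exact ⟨(min_le_right _ _).trans h.1, h.2.trans (le_max_left _ _)⟩
    have hypos : 0 < y := hymin_pos.trans_le hy'.1
    change ‖cexp (-(2 * π * I * (s + y * I) * ξ)) * G (s + y * I)‖ ≤ _
    rw [norm_mul, hker]
    have h1 : Real.exp (2 * π * y * ξ) ≤ Real.exp (2 * π * ymax * |ξ|) := by
      rw [Real.exp_le_exp]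
      have : y * ξ ≤ ymax * |ξ| := by
        calc y * ξ ≤ |y * ξ| := le_abs_self _
          _ = y * |ξ| := by rw [abs_mul, abs_of_pos hypos]
          _ ≤ ymax * |ξ| := mul_le_mul_of_nonneg_right hy'.2 (abs_nonneg _)
      nlinarith [Real.pi_pos]
    have h2 : ‖G (s + y * I)‖ ≤ A * (1 + ymax) ^ N / (1 + s ^ 2) := by
      refine (hb s y hypos).trans ?_
      gcongr
      exact hy'.2
    calc Real.exp (2 * π * y * ξ) * ‖G (s + y * I)‖
        ≤ Real.exp (2 * π * ymax * |ξ|) * (A * (1 + ymax) ^ N / (1 + s ^ 2)) :=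
          mul_le_mul h1 h2 (norm_nonneg _) (by positivity)
      _ = K / (1 + s ^ 2) := by rw [hK]; ring
  have hside : ∀ s : ℝ, ‖∫ y in y₁..y₂, F (s + y * I)‖ ≤ |y₂ - y₁| * (K / (1 + s ^ 2)) := by
    intro s
    rw [mul_comm]
    refine intervalIntegral.norm_integral_le_of_norm_le_const fun y hy => hFside s y ?_
    exact Set.uIoc_subset_uIcc hy
  have hdiff : Tendsto (fun R : ℝ => (∫ x in -R..R, F (x + y₁ * I)) - ∫ x in -R..R, F (x + y₂ * I))
      atTop (𝓝 0) := by
    have hrate : Tendsto (fun R : ℝ => 2 * (|y₂ - y₁| * (K / (1 + R ^ 2)))) atTop (𝓝 0) := by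
      have h1 : Tendsto (fun R : ℝ => 1 + R ^ 2) atTop atTop :=
        tendsto_atTop_add_const_left _ _ (tendsto_pow_atTop two_ne_zero)
      have h2 : Tendsto (fun R : ℝ => K / (1 + R ^ 2)) atTop (𝓝 0) := tendsto_const_nhds.div_atTop h1
      simpa using (h2.const_mul |y₂ - y₁|).const_mul 2
    refine squeeze_zero_norm' ?_ hrate
    filter_upwards [eventually_ge_atTop (0 : ℝ)] with R hR
    -- Cauchy–Goursat on the rectangle with corners `-R + y₁ i`, `R + y₂ i`
    have hrect := Complex.integral_boundary_rect_eq_zero_of_differentiableOn F (-R + y₁ * I)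
      (R + y₂ * I) (by
        intro z hz
        refine (hFd z ?_).differentiableWithinAt
        have hz2 := hz.2
        simp only [add_im, neg_im, ofReal_im, neg_zero, mul_im, ofReal_re, I_im, mul_one, I_re,
          mul_zero, add_zero, zero_add] at hz2
        rcases Set.mem_uIcc.1 hz2 with h' | h' <;> linarith [h'.1, h'.2])
    simp only [add_re, neg_re, ofReal_re, mul_re, I_re, mul_zero, ofReal_im, I_im, mul_one,
      sub_self, add_zero, add_im, neg_im, neg_zero, mul_im, zero_add, ofReal_neg] at hrect
    have heq : (∫ x in -R..R, F (x + y₁ * I)) - (∫ x in -R..R, F (x + y₂ * I))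
        = I • (∫ y in y₁..y₂, F (-R + y * I)) - I • (∫ y in y₁..y₂, F (R + y * I)) := by
      linear_combination hrect
    rw [heq]
    calc ‖I • (∫ y in y₁..y₂, F (-R + y * I)) - I • (∫ y in y₁..y₂, F (R + y * I))‖
        ≤ ‖I • (∫ y in y₁..y₂, F (-R + y * I))‖ + ‖I • (∫ y in y₁..y₂, F (R + y * I))‖ :=
          norm_sub_le _ _
      _ ≤ |y₂ - y₁| * (K / (1 + R ^ 2)) + |y₂ - y₁| * (K / (1 + R ^ 2)) := by
          rw [norm_smul, norm_smul, norm_I, one_mul, one_mul]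
          have h₁ := hside (-R)
          have h₂ := hside R
          rw [neg_sq] at h₁
          push_cast at h₁
          exact add_le_add h₁ h₂
      _ = 2 * (|y₂ - y₁| * (K / (1 + R ^ 2))) := by ring
  have := hlim1.sub hlim2
  have h0 := tendsto_nhds_unique this hdiff
  exact sub_eq_zero.1 h0

/-- **Slices of a polynomially bounded holomorphic function on the upper half-plane have Fourier
transform supported in `[0, ∞)`**: `𝓕 g_y(ξ) = 0` for `ξ < 0`. [folklore] -/
theorem fourier_upperSlice_eq_zero_of_neg (hd : ∀ z : ℂ, 0 < z.im → DifferentiableAt ℂ G z)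
    (hb : ∀ x y : ℝ, 0 < y → ‖G (x + y * I)‖ ≤ A * (1 + y) ^ N / (1 + x ^ 2))
    {y : ℝ} (hy : 0 < y) {ξ : ℝ} (hξ : ξ < 0) :
    𝓕 (fun x : ℝ => G (x + y * I)) ξ = 0 := by
  have hA := nonneg_of_upperSliceBound hb
  set v : ℂ := 𝓕 (fun x : ℝ => G (x + y * I)) ξ with hv
  -- `‖v‖ ≤ π A (1+Y)^N e^{2π(Y-y)ξ}` for every `Y > 0`
  have hbound : ∀ Y : ℝ, 0 < Y → ‖v‖ ≤ π * (A * (1 + Y) ^ N) * Real.exp (2 * π * (Y - y) * ξ) := by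
    intro Y hY
    have h1 := fourier_upperSlice_eq_exp_mul hd hb hY hy ξ
    -- `𝓕 g_y = e^{-2π(y-Y)ξ} 𝓕 g_Y`
    rw [← hv] at h1
    rw [h1, norm_mul, Complex.norm_exp]
    have hre : (-(2 * (π : ℂ) * ((y : ℂ) - Y) * ξ)).re = 2 * π * (Y - y) * ξ := by
      simp only [neg_re, mul_re, sub_re, ofReal_re, ofReal_im, sub_im, mul_im, re_ofNat,
        im_ofNat]
      ring
    rw [hre, mul_comm]
    exact mul_le_mul_of_nonneg_right (norm_fourier_upperSlice_le hb hY ξ) (Real.exp_pos _).le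
  -- the right-hand side tends to `0` as `Y → ∞`
  have hlim : Tendsto (fun Y : ℝ => π * (A * (1 + Y) ^ N) * Real.exp (2 * π * (Y - y) * ξ))
      atTop (𝓝 0) := by
    set c : ℝ := 2 * π * (-ξ) with hc
    have hcpos : 0 < c := by rw [hc]; nlinarith [Real.pi_pos]
    -- `(1+Y)^N e^{-cY} → 0`
    have h1 : Tendsto (fun Y : ℝ => (1 + Y) ^ N * Real.exp (-(c * Y))) atTop (𝓝 0) := by
      have h2 : Tendsto (fun u : ℝ => u ^ N * Real.exp (-u)) atTop (𝓝 0) :=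
        Real.tendsto_pow_mul_exp_neg_atTop_nhds_zero N
      have h3 : Tendsto (fun Y : ℝ => c * (1 + Y)) atTop atTop :=
        (tendsto_atTop_add_const_left _ _ tendsto_id).const_mul_atTop hcpos
      have h4 := h2.comp h3
      have h5 : Tendsto (fun Y : ℝ => (c ^ N)⁻¹ * Real.exp c * ((c * (1 + Y)) ^ N * Real.exp (-(c * (1 + Y)))))
          atTop (𝓝 ((c ^ N)⁻¹ * Real.exp c * 0)) := h4.const_mul _
      rw [mul_zero] at h5
      refine h5.congr fun Y => ?_
      simp only [mul_pow]
      have hcN : c ^ N ≠ 0 := pow_ne_zero _ hcpos.ne'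
      rw [show -(c * (1 + Y)) = -(c * Y) + (-c) by ring, Real.exp_add, Real.exp_neg c]
      field_simp
    have h6 : Tendsto (fun Y : ℝ => π * A * Real.exp (-(2 * π * y * ξ)) *
        ((1 + Y) ^ N * Real.exp (-(c * Y)))) atTop (𝓝 (π * A * Real.exp (-(2 * π * y * ξ)) * 0)) :=
      h1.const_mul _
    rw [mul_zero] at h6
    refine h6.congr fun Y => ?_
    rw [hc, show 2 * π * (Y - y) * ξ = -(2 * π * y * ξ) + -(2 * π * -ξ * Y) by ring, Real.exp_add]
    ring
  have hle : ‖v‖ ≤ 0 :=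
    ge_of_tendsto hlim (by
      filter_upwards [eventually_gt_atTop (0 : ℝ)] with Y hY using hbound Y hY)
  exact norm_le_zero_iff.1 hle

/-- **The Fourier transform of a slice is integrable**: it vanishes on `ξ < 0` and is
`O(e^{-πyξ})` on `ξ ≥ 0`. [folklore] -/
theorem integrable_fourier_upperSlice (hd : ∀ z : ℂ, 0 < z.im → DifferentiableAt ℂ G z)
    (hb : ∀ x y : ℝ, 0 < y → ‖G (x + y * I)‖ ≤ A * (1 + y) ^ N / (1 + x ^ 2)) {y : ℝ} (hy : 0 < y) :
    Integrable (𝓕 (fun x : ℝ => G (x + y * I))) := by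
  have hA := nonneg_of_upperSliceBound hb
  have hy2 : 0 < y / 2 := by positivity
  have hc : Continuous (𝓕 (fun x : ℝ => G (x + y * I))) :=
    Literature.Analysis.FunctionSpaces.continuous_fourierIntegral (integrable_upperSlice hd hb hy)
  set C : ℝ := π * (A * (1 + y / 2) ^ N) with hC
  have hCnn : 0 ≤ C := by positivity
  set bnd : ℝ → ℝ := (Ici (0 : ℝ)).indicator fun ξ => C * Real.exp (-(π * y) * ξ) with hbnd
  have hbnd_int : Integrable bnd := by
    rw [hbnd, integrable_indicator_iff measurableSet_Ici]
    rw [integrableOn_Ici_iff_integrableOn_Ioi]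
    exact ((exp_neg_integrableOn_Ioi 0 (by positivity : 0 < π * y)).const_mul C)
  refine Integrable.mono' hbnd_int hc.aestronglyMeasurable (Eventually.of_forall fun ξ => ?_)
  by_cases hξ : 0 ≤ ξ
  · rw [hbnd, indicator_of_mem (mem_Ici.2 hξ), fourier_upperSlice_eq_exp_mul hd hb hy2 hy ξ, norm_mul,
      Complex.norm_exp]
    have hre : (-(2 * (π : ℂ) * ((y : ℂ) - (y / 2 : ℝ)) * ξ)).re = -(π * y) * ξ := by
      simp only [neg_re, mul_re, sub_re, ofReal_re, ofReal_im, sub_im, mul_im, re_ofNat, im_ofNat]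
      ring
    rw [hre, mul_comm]
    exact mul_le_mul_of_nonneg_right (norm_fourier_upperSlice_le hb hy2 ξ) (Real.exp_pos _).le
  · push Not at hξ
    rw [hbnd, indicator_of_notMem (by simpa using hξ), fourier_upperSlice_eq_zero_of_neg hd hb hy hξ,
      norm_zero]

/-- **Fourier inversion for slices**: `g_y = 𝓕⁻ 𝓕 g_y`. [folklore] -/
theorem fourierInv_fourier_upperSlice (hd : ∀ z : ℂ, 0 < z.im → DifferentiableAt ℂ G z)
    (hb : ∀ x y : ℝ, 0 < y → ‖G (x + y * I)‖ ≤ A * (1 + y) ^ N / (1 + x ^ 2)) {y : ℝ} (hy : 0 < y) :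
    𝓕⁻ (𝓕 (fun x : ℝ => G (x + y * I))) = fun x : ℝ => G (x + y * I) :=
  (continuous_upperSlice hd hy).fourierInv_fourier_eq (integrable_upperSlice hd hb hy)
    (integrable_fourier_upperSlice hd hb hy)

end Slices

section BoundaryValue

variable {G : ℂ → ℂ} {A : ℝ} {N : ℕ}

/-- `‖φ‖‖η‖` is integrable for `φ, η ∈ L²` (via `2ab ≤ a² + b²`). [folklore] -/
theorem integrable_norm_mul_norm_of_memLp_two {φ η : ℝ → ℂ} (hφ : MemLp φ 2 volume)
    (hη : MemLp η 2 volume) : Integrable fun ξ => ‖φ ξ‖ * ‖η ξ‖ := by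
  have h1 : Integrable (fun ξ => ‖φ ξ‖ ^ 2) := (memLp_two_iff_integrable_sq_norm hφ.1).1 hφ
  have h2 : Integrable (fun ξ => ‖η ξ‖ ^ 2) := (memLp_two_iff_integrable_sq_norm hη.1).1 hη
  refine Integrable.mono' (h1.add h2) (hφ.1.norm.mul hη.1.norm) (Eventually.of_forall fun ξ => ?_)
  rw [Real.norm_eq_abs, abs_of_nonneg (by positivity), Pi.add_apply]
  nlinarith [sq_nonneg (‖φ ξ‖ - ‖η ξ‖), norm_nonneg (φ ξ), norm_nonneg (η ξ)]

/-- Hölder on `L² × L²` in the form `‖∫ f h‖ ≤ ‖f‖₂ ‖h‖₂` with `‖f‖₂ = (eLpNorm f 2).toReal`.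
[folklore] -/
theorem norm_integral_mul_le_eLpNorm_mul {f h : ℝ → ℂ} (hf : MemLp f 2 volume)
    (hh : MemLp h 2 volume) :
    ‖∫ x, f x * h x‖ ≤ (eLpNorm f 2 volume).toReal * (eLpNorm h 2 volume).toReal := by
  have hpq : (2 : ℝ).HolderConjugate 2 := Real.HolderConjugate.two_two
  have h2 : ENNReal.ofReal (2 : ℝ) = 2 := by norm_num
  have hf' : MemLp f (ENNReal.ofReal 2) volume := by rwa [h2]
  have hh' : MemLp h (ENNReal.ofReal 2) volume := by rwa [h2]
  have hH := integral_mul_norm_le_Lp_mul_Lq hpq hf' hh'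
  have hfe : (∫ x, ‖f x‖ ^ (2 : ℝ)) ^ (1 / (2 : ℝ)) = (eLpNorm f 2 volume).toReal := by
    rw [hf.eLpNorm_eq_integral_rpow_norm two_ne_zero ENNReal.ofNat_ne_top,
      ENNReal.toReal_ofReal (by positivity)]
    norm_num
  have hhe : (∫ x, ‖h x‖ ^ (2 : ℝ)) ^ (1 / (2 : ℝ)) = (eLpNorm h 2 volume).toReal := by
    rw [hh.eLpNorm_eq_integral_rpow_norm two_ne_zero ENNReal.ofNat_ne_top,
      ENNReal.toReal_ofReal (by positivity)]
    norm_num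
  calc ‖∫ x, f x * h x‖ ≤ ∫ x, ‖f x * h x‖ := norm_integral_le_integral_norm _
    _ = ∫ x, ‖f x‖ * ‖h x‖ := by simp_rw [norm_mul]
    _ ≤ (∫ x, ‖f x‖ ^ (2 : ℝ)) ^ (1 / (2 : ℝ)) * (∫ x, ‖h x‖ ^ (2 : ℝ)) ^ (1 / (2 : ℝ)) := hH
    _ = (eLpNorm f 2 volume).toReal * (eLpNorm h 2 volume).toReal := by rw [hfe, hhe]

/-- **Paley–Wiener on the upper half-plane, boundary values.** Let `G` be holomorphic on
`{Im z > 0}` with `‖G(x+iy)‖ ≤ A(1+y)^N/(1+x²)`. Then there are a spectral function `φ ∈ L²(ℝ)`,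
continuous, vanishing on `(-∞, 0)`, with `𝓕 g_y = e^{-2πy·} φ` for every `y > 0`, and a boundary
function `g ∈ L²(ℝ)` such that the slices `g_{1/(n+1)} = G(· + i/(n+1))` converge to `g` a.e. along
a subsequence, `∫ φ η = ∫ g 𝓕η` for every `η ∈ L¹ ∩ L²`, and `g = 𝓕⁻ φ'` a.e. for every integrable
`φ' = φ` a.e. (Katznelson VI.7; Rudin, *Real and complex analysis*, 19.2.) [folklore] -/
theorem paleyWiener_halfPlane_boundaryValue (hd : ∀ z : ℂ, 0 < z.im → DifferentiableAt ℂ G z)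
    (hb : ∀ x y : ℝ, 0 < y → ‖G (x + y * I)‖ ≤ A * (1 + y) ^ N / (1 + x ^ 2)) :
    ∃ φ g : ℝ → ℂ, Continuous φ ∧ (∀ ξ, ξ < 0 → φ ξ = 0) ∧ MemLp φ 2 volume ∧ MemLp g 2 volume ∧
      (∀ y : ℝ, 0 < y → ∀ ξ, 𝓕 (fun x : ℝ => G (x + y * I)) ξ = cexp (-(2 * π * y * ξ)) * φ ξ) ∧
      (∃ ns : ℕ → ℕ, StrictMono ns ∧
        ∀ᵐ x : ℝ, Tendsto (fun k => G (x + (1 / ((ns k : ℝ) + 1) : ℝ) * I)) atTop (𝓝 (g x))) ∧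
      (∀ η : ℝ → ℂ, Integrable η → MemLp η 2 volume → ∫ ξ, φ ξ * η ξ = ∫ x, g x * 𝓕 η x) ∧
      (∀ φ' : ℝ → ℂ, φ' =ᵐ[volume] φ → Integrable φ' → g =ᵐ[volume] 𝓕⁻ φ') := by
  have hA := nonneg_of_upperSliceBound hb
  -- the spectral function
  set φ : ℝ → ℂ := fun ξ => cexp (2 * π * ξ) * 𝓕 (fun x : ℝ => G (x + (1 : ℝ) * I)) ξ with hφdef
  have hφcont : Continuous φ :=
    (by fun_prop : Continuous fun ξ : ℝ => cexp (2 * π * ξ)).mul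
      (Literature.Analysis.FunctionSpaces.continuous_fourierIntegral (integrable_upperSlice hd hb one_pos))
  have hφneg : ∀ ξ, ξ < 0 → φ ξ = 0 := fun ξ hξ => by
    rw [hφdef]; simp only
    rw [fourier_upperSlice_eq_zero_of_neg hd hb one_pos hξ, mul_zero]
  have hφy : ∀ y : ℝ, 0 < y → ∀ ξ,
      𝓕 (fun x : ℝ => G (x + y * I)) ξ = cexp (-(2 * π * y * ξ)) * φ ξ := by
    intro y hy ξ
    rw [fourier_upperSlice_eq_exp_mul hd hb one_pos hy ξ, hφdef]
    simp only
    rw [← mul_assoc, ← Complex.exp_add]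
    congr 2
    push_cast
    ring
  -- the slices along `y_n = 1/(n+1)`
  set ys : ℕ → ℝ := fun n => 1 / ((n : ℝ) + 1) with hys
  have hys_pos : ∀ n, 0 < ys n := fun n => by rw [hys]; positivity
  have hys_le : ∀ n, ys n ≤ 1 := fun n => by
    rw [hys]; simp only
    rw [div_le_one (by positivity)]; linarith [n.cast_nonneg (α := ℝ)]
  have hys_lim : Tendsto ys atTop (𝓝 0) := by
    rw [hys]
    exact tendsto_one_div_add_atTop_nhds_zero_nat
  set gs : ℕ → ℝ → ℂ := fun n x => G (x + (ys n) * I) with hgs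
  have hgs_int : ∀ n, Integrable (gs n) := fun n => integrable_upperSlice hd hb (hys_pos n)
  have hgs_L2 : ∀ n, MemLp (gs n) 2 volume := fun n => memLp_two_upperSlice hd hb (hys_pos n)
  have hgs_cont : ∀ n, Continuous (gs n) := fun n => continuous_upperSlice hd (hys_pos n)
  -- their Fourier transforms
  set Φ : ℕ → ℝ → ℂ := fun n ξ => cexp (-(2 * π * ys n * ξ)) * φ ξ with hΦ
  have hΦeq : ∀ n, 𝓕 (gs n) = Φ n := fun n => funext fun ξ => hφy (ys n) (hys_pos n) ξ
  have hΦ_L2 : ∀ n, MemLp (Φ n) 2 volume := fun n => by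
    rw [← hΦeq]
    exact Literature.Analysis.FunctionSpaces.memLp_two_fourierIntegral (hgs_int n) (hgs_L2 n)
  have hΦcont : ∀ n, Continuous (Φ n) := fun n =>
    (by fun_prop : Continuous fun ξ : ℝ => cexp (-(2 * π * ys n * ξ))).mul hφcont
  -- norms: `‖Φ n ξ‖ ≤ ‖φ ξ‖`, with equality in the limit
  have hexp_le : ∀ (y ξ : ℝ), 0 < y → ‖cexp (-(2 * π * y * ξ)) * φ ξ‖ ≤ ‖φ ξ‖ := by
    intro y ξ hy
    by_cases hξ : 0 ≤ ξ
    · rw [norm_mul, Complex.norm_exp]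
      have hre : (-(2 * (π : ℂ) * y * ξ)).re = -(2 * π * y * ξ) := by
        simp only [neg_re, mul_re, ofReal_re, ofReal_im, mul_im, re_ofNat, im_ofNat]; ring
      rw [hre]
      have : Real.exp (-(2 * π * y * ξ)) ≤ 1 := by
        rw [Real.exp_le_one_iff]; nlinarith [Real.pi_pos, mul_nonneg hy.le hξ]
      exact mul_le_of_le_one_left (norm_nonneg _) this
    · push Not at hξ
      rw [hφneg ξ hξ, mul_zero, norm_zero]
  have hΦ_le : ∀ n ξ, ‖Φ n ξ‖ ≤ ‖φ ξ‖ := fun n ξ => hexp_le (ys n) ξ (hys_pos n)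
  have hΦ_lim : ∀ ξ, Tendsto (fun n => Φ n ξ) atTop (𝓝 (φ ξ)) := by
    intro ξ
    have h1 : Tendsto (fun n => cexp (-(2 * π * ys n * ξ))) atTop (𝓝 (cexp (-(2 * π * (0 : ℝ) * ξ)))) := by
      have hc : Continuous fun y : ℝ => cexp (-(2 * π * y * ξ)) := by fun_prop
      exact (hc.tendsto 0).comp hys_lim
    simp only [ofReal_zero, mul_zero, zero_mul, neg_zero, Complex.exp_zero] at h1
    have := h1.mul (tendsto_const_nhds (x := φ ξ))
    rwa [one_mul] at this
  -- uniform `L²` bound on the slices for `y ≤ 1`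
  set B : ℝ := π * (A * 2 ^ N) ^ 2 with hB
  have hgs_sq_le : ∀ n, ∫ x, ‖gs n x‖ ^ 2 ≤ B := by
    intro n
    refine (integral_norm_sq_upperSlice_le hd hb (hys_pos n)).2.trans ?_
    rw [hB]
    have h1 : (1 + ys n) ^ N ≤ 2 ^ N := by
      apply pow_le_pow_left₀ (by linarith [hys_pos n]) (by linarith [hys_le n])
    have h2 : A * (1 + ys n) ^ N ≤ A * 2 ^ N := mul_le_mul_of_nonneg_left h1 hA
    have h3 : 0 ≤ A * (1 + ys n) ^ N := by positivity
    nlinarith [Real.pi_pos, mul_self_le_mul_self h3 h2]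
  -- `φ ∈ L²` by Fatou
  have hφ_lint : ∫⁻ ξ, ‖φ ξ‖ₑ ^ 2 ≤ ENNReal.ofReal B := by
    have hF : ∀ n, ∫⁻ ξ, ‖Φ n ξ‖ₑ ^ 2 ≤ ENNReal.ofReal B := by
      intro n
      rw [← hΦeq, Literature.Analysis.FunctionSpaces.lintegral_enorm_sq_fourierIntegral_eq
        (hgs_int n) (hgs_L2 n)]
      have hi := (integral_norm_sq_upperSlice_le hd hb (hys_pos n)).1
      have : ∫⁻ x, ‖gs n x‖ₑ ^ 2 = ENNReal.ofReal (∫ x, ‖gs n x‖ ^ 2) := by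
        rw [ofReal_integral_eq_lintegral_ofReal hi (Eventually.of_forall fun _ => by positivity)]
        refine lintegral_congr fun x => ?_
        rw [← ofReal_norm, ← ENNReal.ofReal_pow (norm_nonneg _)]
      rw [this]
      exact ENNReal.ofReal_le_ofReal (hgs_sq_le n)
    have hlim : ∀ ξ, liminf (fun n => ‖Φ n ξ‖ₑ ^ 2) atTop = ‖φ ξ‖ₑ ^ 2 := by
      intro ξ
      refine Tendsto.liminf_eq ?_
      exact ((ENNReal.continuous_pow 2).tendsto _).comp (hΦ_lim ξ).enorm
    calc ∫⁻ ξ, ‖φ ξ‖ₑ ^ 2 = ∫⁻ ξ, liminf (fun n => ‖Φ n ξ‖ₑ ^ 2) atTop := by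
          refine lintegral_congr fun ξ => (hlim ξ).symm
      _ ≤ liminf (fun n => ∫⁻ ξ, ‖Φ n ξ‖ₑ ^ 2) atTop :=
          lintegral_liminf_le' fun n => ((hΦcont n).measurable.enorm.pow_const 2).aemeasurable
      _ ≤ limsup (fun n => ∫⁻ ξ, ‖Φ n ξ‖ₑ ^ 2) atTop := liminf_le_limsup
      _ ≤ ⨆ n, ∫⁻ ξ, ‖Φ n ξ‖ₑ ^ 2 := limsup_le_iSup
      _ ≤ ENNReal.ofReal B := iSup_le hF
  have hφ_L2 : MemLp φ 2 volume := by
    refine (memLp_two_iff_integrable_sq_norm hφcont.aestronglyMeasurable).2 ⟨?_, ?_⟩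
    · exact (hφcont.norm.pow 2).aestronglyMeasurable
    · rw [hasFiniteIntegral_iff_enorm]
      calc ∫⁻ ξ, ‖‖φ ξ‖ ^ 2‖ₑ = ∫⁻ ξ, ‖φ ξ‖ₑ ^ 2 := by
            refine lintegral_congr fun ξ => ?_
            rw [Real.enorm_eq_ofReal (by positivity), ← ofReal_norm,
              ENNReal.ofReal_pow (norm_nonneg _)]
        _ ≤ ENNReal.ofReal B := hφ_lint
        _ < ⊤ := ENNReal.ofReal_lt_top
  -- `Φ n → φ` in `L²` (dominated convergence)
  have hΦ_tend : Tendsto (fun n => eLpNorm (Φ n - φ) 2 volume) atTop (𝓝 0) := by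
    have hdct : Tendsto (fun n => ∫⁻ ξ, ‖(Φ n - φ) ξ‖ₑ ^ 2) atTop (𝓝 (∫⁻ _ : ℝ, (0 : ℝ≥0∞))) := by
      refine tendsto_lintegral_of_dominated_convergence (fun ξ => ‖φ ξ‖ₑ ^ 2) ?_ ?_ ?_ ?_
      · intro n
        exact ((hΦcont n).sub hφcont).measurable.enorm.pow_const _
      · intro n
        refine Eventually.of_forall fun ξ => ?_
        simp only [Pi.sub_apply]
        gcongr
        rw [← ofReal_norm, ← ofReal_norm]
        refine ENNReal.ofReal_le_ofReal ?_
        by_cases hξ : 0 ≤ ξ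
        · rw [hΦ]; simp only
          rw [show cexp (-(2 * π * ys n * ξ)) * φ ξ - φ ξ = (cexp (-(2 * π * ys n * ξ)) - 1) * φ ξ by ring,
            norm_mul]
          refine mul_le_of_le_one_left (norm_nonneg _) ?_
          have hre : (-(2 * (π : ℂ) * (ys n : ℝ) * ξ)) = ((-(2 * π * ys n * ξ) : ℝ) : ℂ) := by push_cast; ring
          rw [hre, ← Complex.ofReal_exp, ← Complex.ofReal_one, ← Complex.ofReal_sub, Complex.norm_real,
            Real.norm_eq_abs, abs_le]
          have h1 : Real.exp (-(2 * π * ys n * ξ)) ≤ 1 := by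
            rw [Real.exp_le_one_iff]; nlinarith [Real.pi_pos, mul_nonneg (hys_pos n).le hξ]
          constructor <;> nlinarith [Real.exp_pos (-(2 * π * ys n * ξ))]
        · push Not at hξ
          rw [hΦ]; simp only
          rw [hφneg ξ hξ, mul_zero, sub_zero]
      · exact ne_top_of_le_ne_top ENNReal.ofReal_ne_top hφ_lint
      · refine Eventually.of_forall fun ξ => ?_
        have h1 : Tendsto (fun n => (Φ n - φ) ξ) atTop (𝓝 0) := by
          simp only [Pi.sub_apply]
          have := (hΦ_lim ξ).sub (tendsto_const_nhds (x := φ ξ))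
          rwa [sub_self] at this
        have h2 := h1.enorm
        rw [enorm_zero] at h2
        have h3 := ((ENNReal.continuous_pow 2).tendsto 0).comp h2
        simpa [Function.comp_def] using h3
    simp only [lintegral_zero] at hdct
    have h4 : ∀ n, eLpNorm (Φ n - φ) 2 volume = (∫⁻ ξ, ‖(Φ n - φ) ξ‖ₑ ^ 2) ^ (1 / (2 : ℝ)) := by
      intro n
      rw [eLpNorm_eq_lintegral_rpow_enorm_toReal two_ne_zero ENNReal.ofNat_ne_top]
      norm_num
    simp_rw [h4]
    have h5 := hdct.ennrpow_const (1 / (2 : ℝ))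
    rw [ENNReal.zero_rpow_of_pos (by norm_num : (0 : ℝ) < 1 / 2)] at h5
    exact h5
  -- transport to `L²`: the classes of `gs n` converge to `U := 𝓕⁻ [φ]`
  set U : Lp ℂ 2 (volume : Measure ℝ) := 𝓕⁻ (hφ_L2.toLp φ) with hU
  have hconvΦ : Tendsto (fun n => (hΦ_L2 n).toLp (Φ n)) atTop (𝓝 (hφ_L2.toLp φ)) :=
    (Lp.tendsto_Lp_iff_tendsto_eLpNorm'' _ hΦ_L2 φ hφ_L2).2 hΦ_tend
  have hFourier_n : ∀ n, (𝓕 ((hgs_L2 n).toLp (gs n)) : Lp ℂ 2 (volume : Measure ℝ)) =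
      (hΦ_L2 n).toLp (Φ n) := by
    intro n
    refine Lp.ext_iff.2 ?_
    refine (Literature.Analysis.FunctionSpaces.fourier_toLp_ae_eq_fourierIntegral
      (hgs_int n) (hgs_L2 n)).trans ?_
    rw [hΦeq n]
    exact ((hΦ_L2 n).coeFn_toLp).symm
  have hgs_eq : ∀ n, (hgs_L2 n).toLp (gs n) = (𝓕⁻ ((hΦ_L2 n).toLp (Φ n)) : Lp ℂ 2 (volume : Measure ℝ)) := by
    intro n
    rw [← hFourier_n n, FourierTransform.fourierInv_fourier_eq]
  have hconv_gs : Tendsto (fun n => (hgs_L2 n).toLp (gs n)) atTop (𝓝 U) := by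
    simp_rw [hgs_eq, hU]
    exact ((FourierTransform.continuous_fourierInv (E := Lp ℂ 2 (volume : Measure ℝ))).tendsto _).comp hconvΦ
  -- the boundary function
  set g : ℝ → ℂ := (U : ℝ → ℂ) with hgdef
  have hg_L2 : MemLp g 2 volume := Lp.memLp U
  have hU_eq : U = hg_L2.toLp g := (Lp.toLp_coeFn U hg_L2).symm
  have hgs_tend : Tendsto (fun n => eLpNorm (gs n - g) 2 volume) atTop (𝓝 0) := by
    rw [hU_eq] at hconv_gs
    exact (Lp.tendsto_Lp_iff_tendsto_eLpNorm'' _ hgs_L2 g hg_L2).1 hconv_gs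
  -- a.e. convergence along a subsequence
  have hmeas : TendstoInMeasure volume gs atTop g :=
    tendstoInMeasure_of_tendsto_eLpNorm two_ne_zero (fun n => (hgs_L2 n).1) hg_L2.1 hgs_tend
  obtain ⟨ns, hns, hae⟩ := hmeas.exists_seq_tendsto_ae
  refine ⟨φ, g, hφcont, hφneg, hφ_L2, hg_L2, hφy, ⟨ns, hns, ?_⟩, ?_, ?_⟩
  · filter_upwards [hae] with x hx
    exact hx
  · -- the pairing identity
    intro η hη hη2
    have hFη_L2 : MemLp (𝓕 η) 2 volume :=
      Literature.Analysis.FunctionSpaces.memLp_two_fourierIntegral hη hη2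
    have hn : ∀ n, ∫ ξ, Φ n ξ * η ξ = ∫ x, gs n x * 𝓕 η x := by
      intro n
      rw [← hΦeq]
      exact integral_fourier_mul_eq_integral_mul_fourier (hgs_int n) hη
    -- left-hand sides converge to `∫ φ η`
    have hL : Tendsto (fun n => ∫ ξ, Φ n ξ * η ξ) atTop (𝓝 (∫ ξ, φ ξ * η ξ)) := by
      refine tendsto_integral_of_dominated_convergence (fun ξ => ‖φ ξ‖ * ‖η ξ‖)
        (fun n => ((hΦcont n).aestronglyMeasurable.mul hη.1)) ?_ ?_ ?_
      · exact integrable_norm_mul_norm_of_memLp_two hφ_L2 hη2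
      · intro n
        refine Eventually.of_forall fun ξ => ?_
        rw [norm_mul]
        exact mul_le_mul_of_nonneg_right (hΦ_le n ξ) (norm_nonneg _)
      · exact Eventually.of_forall fun ξ => (hΦ_lim ξ).mul tendsto_const_nhds
    -- right-hand sides converge to `∫ g 𝓕η`
    have hR : Tendsto (fun n => ∫ x, gs n x * 𝓕 η x) atTop (𝓝 (∫ x, g x * 𝓕 η x)) := by
      rw [tendsto_iff_norm_sub_tendsto_zero]
      have hbd : ∀ n, ‖(∫ x, gs n x * 𝓕 η x) - ∫ x, g x * 𝓕 η x‖ ≤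
          (eLpNorm (gs n - g) 2 volume).toReal * (eLpNorm (𝓕 η) 2 volume).toReal := by
        intro n
        have hi1 : Integrable fun x => gs n x * 𝓕 η x := by
          refine Integrable.mono' (integrable_norm_mul_norm_of_memLp_two (hgs_L2 n) hFη_L2)
            ((hgs_L2 n).1.mul hFη_L2.1) (Eventually.of_forall fun x => ?_)
          rw [norm_mul]
        have hi2 : Integrable fun x => g x * 𝓕 η x := by
          refine Integrable.mono' (integrable_norm_mul_norm_of_memLp_two hg_L2 hFη_L2)
            (hg_L2.1.mul hFη_L2.1) (Eventually.of_forall fun x => ?_)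
          rw [norm_mul]
        rw [← integral_sub hi1 hi2]
        have : (fun x => gs n x * 𝓕 η x - g x * 𝓕 η x) = fun x => (gs n - g) x * 𝓕 η x := by
          funext x; simp only [Pi.sub_apply]; ring
        rw [this]
        exact norm_integral_mul_le_eLpNorm_mul ((hgs_L2 n).sub hg_L2) hFη_L2
      have hto : Tendsto (fun n => (eLpNorm (gs n - g) 2 volume).toReal * (eLpNorm (𝓕 η) 2 volume).toReal)
          atTop (𝓝 (0 * (eLpNorm (𝓕 η) 2 volume).toReal)) := by
        refine Tendsto.mul_const _ ?_
        have := (ENNReal.tendsto_toReal ENNReal.zero_ne_top).comp hgs_tend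
        simpa [Function.comp_def] using this
      rw [zero_mul] at hto
      exact squeeze_zero (fun n => norm_nonneg _) hbd hto
    have hL' : Tendsto (fun n => ∫ ξ, Φ n ξ * η ξ) atTop (𝓝 (∫ x, g x * 𝓕 η x)) := by
      simp_rw [hn]; exact hR
    exact tendsto_nhds_unique hL hL'
  · -- the representation `g = 𝓕⁻ φ'`
    intro φ' hφ' hφ'int
    have hpt : ∀ x, Tendsto (fun k => gs (ns k) x) atTop (𝓝 (𝓕⁻ φ' x)) := by
      intro x
      -- `gs n x = 𝓕⁻ (Φ n) x = ∫ 𝐞⟪v, x⟫ • e^{-2π y_n v} φ' v dv`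
      have h1 : ∀ n, gs n x =
          ∫ v, 𝐞 (inner ℝ v x) • (cexp (-(2 * π * ys n * v)) * φ' v) := by
        intro n
        have h2 := congrFun (fourierInv_fourier_upperSlice hd hb (hys_pos n)) x
        change 𝓕⁻ (𝓕 (gs n)) x = gs n x at h2
        rw [← h2, hΦeq, Real.fourierInv_eq]
        refine integral_congr_ae ?_
        filter_upwards [hφ'] with v hv
        rw [hΦ, hv]
      simp_rw [h1]
      rw [Real.fourierInv_eq]
      refine tendsto_integral_of_dominated_convergence (fun v => ‖φ' v‖) ?_ hφ'int.norm ?_ ?_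
      · intro k
        refine AEStronglyMeasurable.smul ?_ ?_
        · have hc : Continuous fun v : ℝ => ((𝐞 (inner ℝ v x) : Circle) : ℂ) :=
            continuous_subtype_val.comp
              (Real.continuous_fourierChar.comp (continuous_id.inner continuous_const))
          exact hc.aestronglyMeasurable
        · exact ((by fun_prop : Continuous fun v : ℝ => cexp (-(2 * π * ys (ns k) * v))).aestronglyMeasurable).mul
            hφ'int.1
      · intro k
        filter_upwards [hφ'] with v hv
        rw [Circle.norm_smul, hv]
        exact hexp_le (ys (ns k)) v (hys_pos _)
      · refine Eventually.of_forall fun v => ?_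
        refine Tendsto.smul tendsto_const_nhds ?_
        have hc : Continuous fun y : ℝ => cexp (-(2 * π * y * v)) * φ' v := by fun_prop
        have h3 := (hc.tendsto 0).comp (hys_lim.comp hns.tendsto_atTop)
        simpa [Function.comp_def] using h3
    filter_upwards [hae] with x hx
    exact tendsto_nhds_unique hx (hpt x)

end BoundaryValue

end Literature.Analysis.Fourier
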